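import Literature.NumberTheory.Automorphic.AdeleQuotientFourierInversion
import Mathlib.Analysis.Normed.Group.Tannery
import Mathlib.Topology.UrysohnsLemma
import HarnessLib

/-!
# Fejér kernels on `𝔸_K ⧸ K` and the value «at the origin» of a pushed-forward measure
# (Weil, *Sur la formule de Siegel*, Chap. I n° 1–2, Lemme 1 with `T = δ₀`, over the compact quotient)

Topic `NumberTheory/Automorphic`; namespace `Literature.NumberTheory.Automorphic` (continues
`AdeleQuotientFourier`, `AdeleQuotientFourierInversion`).  KERNEL ONLY: theorems, no definition, no named fact,
no `sorry`.

THE PRINTED MATHEMATICS.  [Weil1965, Chap. I n° 1, Lemme 1 p. 4]: «Soit ξ une fonction bornée localement intégrable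
sur `G*`; soit `T` la distribution tempérée sur `G`, transformée de Fourier de ξ.  Pour tout voisinage compact `W` de 0
dans `G`, soit `φ_W` une fonction continue `≥ 0` sur `G`, de support contenu dans `W`, telle que `∫ φ_W dg = 1`; et soit
`t_W = φ_W ∗ T ∗ φ̃_W`.  Alors les `t_W` sont des fonctions continues et bornées sur `G`; et, chaque fois que `Φ ∈ L¹(X)`
est telle que l'intégrale (2) `S(Φ) = ∫ F*_Φ(−g*) ξ(g*) dg*` soit absolument convergente, on a aussi (3)
`S(Φ) = lim_W ∫ t_W(f(x)) Φ(x) dx`.»  Here (n° 2, Prop. 2 p. 7, the reduction of Poisson summation to the COMPACT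
quotient `G/Γ`, whose dual is the discrete `Γ_*`): `G := 𝔸_K ⧸ K`, `G* = K` through Tate's characters
`ψ_ξ(u) = ψ(ξu)` (`adeleQuotChar`), `T := δ₀` (so `ξ ≡ 1`, `t_W = φ_W ∗ φ̃_W ≥ 0` is the FEJÉR KERNEL of `φ_W` and
`S(Φ) = Σ_{ξ ∈ K} F*_Φ(ξ)`), and `F*_Φ(ξ) = ∫_X ψ_ξ(f(x)) Φ(x) dx` for a measurable `f : X → 𝔸_K ⧸ K` on any measure
space `(X, dx)` ([Weil1965, Chap. I (1) p. 3]).  The content of this file is exactly Lemme 1 in that case, by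
Fourier SERIES on the compact group (no tempered distributions, no Fourier inversion on a non-compact group):

* §1 the Fejér kernel `t_φ(u) := ∫ φ(v) φ(v + u) dv` of a continuous real `φ` on `𝔸_K ⧸ K`: continuous
  (`continuous_fejer`), non-negative for `φ ≥ 0`, vanishing off `supp φ − supp φ` (`fejer_eq_zero_of_forall`), with
  Fourier coefficients `∫ \overline{ψ_ξ} t_φ = |φ̂(ξ)|²` (`integral_conj_adeleQuotChar_mul_fejer`), which are summable
  (Bessel, ★ `AdeleQuotientFourier`) and `≤ (∫|φ|)²`;
* §2 **`integral_fejer_comp_mul_eq_tsum`** — for `Φ ∈ L¹(X)`: `∫_X t_φ(f(x)) Φ(x) dx = Σ_{ξ ∈ K} |φ̂(ξ)|² F*_Φ(ξ)`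
  (pointwise inversion ★ `eq_tsum_integral_mul_adeleQuotChar` + dominated interchange);
* §3 **`tendsto_integral_fejer_comp_mul`** — Weil's (3): along any sequence `φ_n ≥ 0`, `∫ φ_n = 1`, supports
  shrinking to `0`, and whenever `Σ_ξ |F*_Φ(ξ)| < ∞` (Weil's (2) absolutely convergent):
  `∫_X t_{φ_n}(f(x)) Φ(x) dx ⟶ S(Φ) := Σ_{ξ ∈ K} F*_Φ(ξ)` (Tannery); consequences: `S(Φ)` is a NON-NEGATIVE REAL for
  `Φ ≥ 0` (`tsum_nonneg_of_summable` — Lemme 3 p. 5: «si `T` est une mesure positive, il en est de même de `S`»), and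
  `S(Φ) = 0` when `f` stays outside a neighbourhood of `0` on the support of `Φ` (Lemme 3: «de support contenu dans
  `f⁻¹(supp T)`»);
* §4 `exists_fejer_approximateUnit` — such sequences `φ_n` exist (Urysohn on the compact metrisable group, Haar charges
  open sets).

Downstream (`Weil1965/AdelicFibreMeasures`): `X = X_𝔸`, `f = π ∘ i_X` the doubled hermitian norm read in `𝔸_F ⧸ F`,
`S(Φ) = E_X(Φ)` the Siegel–Eisenstein measure of [Weil1965, n° 41 (34)]; the fibre measures `μ_b` are the pieces of the
positive functional `S` over `b ∈ F`.

## References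
* [Weil1965] A. Weil, *Sur la formule de Siegel dans la théorie des groupes classiques*, Acta Math. 113 (1965) 1–87,
  Chap. I n° 1–2 pp. 3–8 (Lemmes 1–3, Prop. 1–2), Chap. IV n° 41 pp. 58–59.
* [CasselsFrohlichANT1967] J. Tate, Ch. XV §4.2 (Fourier series on `𝔸_K ⧸ K`).
-/

set_option autoImplicit false

noncomputable section

open _root_.MeasureTheory _root_.MeasureTheory.Measure Set Filter IsDedekindDomain NumberField
open _root_.Topology
open scoped ENNReal ComplexConjugate Classical

namespace Literature.NumberTheory.Automorphic

section Fejer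

variable (K : Type) [Field K] [NumberField K]
  [MeasurableSpace (adeleQuotient K)] [BorelSpace (adeleQuotient K)]

/-! ## §1 The Fejér kernel of a continuous function on `𝔸_K ⧸ K` -/

omit [MeasurableSpace (adeleQuotient K)] [BorelSpace (adeleQuotient K)] in
/-- a continuous real function on the compact group `𝔸_K ⧸ K` is bounded. [folklore] -/
private theorem exists_forall_abs_le_of_continuous {φ : adeleQuotient K → ℝ} (hφ : Continuous φ) :
    ∃ M : ℝ, 0 ≤ M ∧ ∀ u, |φ u| ≤ M :=
  ⟨‖(⟨φ, hφ⟩ : C(adeleQuotient K, ℝ))‖, norm_nonneg _,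
    fun u => (Real.norm_eq_abs _).symm.le.trans ((⟨φ, hφ⟩ : C(adeleQuotient K, ℝ)).norm_coe_le_norm u)⟩

/-- **the Fejér kernel `t_φ(u) = ∫ φ(v) φ(v + u) dv` is continuous** (dominated convergence: the integrand is continuous
in `u` and bounded by `sup|φ|²` on the probability space `𝔸_K ⧸ K`). [cite: Weil1965, Chap. I n° 1 Lemme 1 p. 4] -/
theorem continuous_fejer {φ : adeleQuotient K → ℝ} (hφ : Continuous φ) :
    Continuous fun u : adeleQuotient K => ∫ v, (φ v : ℂ) * (φ (v + u) : ℂ) ∂(adeleQuotHaar K) := by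
  obtain ⟨M, hM0, hM⟩ := exists_forall_abs_le_of_continuous K hφ
  refine continuous_of_dominated (bound := fun _ => M * M) (fun u => ?_) (fun u => ae_of_all _ fun v => ?_)
    (integrable_const _) (ae_of_all _ fun v => ?_)
  · exact ((Complex.continuous_ofReal.comp hφ).mul
      (Complex.continuous_ofReal.comp (hφ.comp (continuous_id.add continuous_const)))).aestronglyMeasurable
  · rw [norm_mul, Complex.norm_real, Complex.norm_real, Real.norm_eq_abs, Real.norm_eq_abs]
    exact mul_le_mul (hM v) (hM (v + u)) (abs_nonneg _) hM0
  · exact continuous_const.mul (Complex.continuous_ofReal.comp (hφ.comp (continuous_const.add continuous_id)))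

/-- the Fejér kernel of a real function is real, pointwise. [cite: Weil1965, Chap. I n° 1 Lemme 3 p. 5] -/
theorem fejer_eq_ofReal_of_nonneg (φ : adeleQuotient K → ℝ) (u : adeleQuotient K) :
    ∫ v, (φ v : ℂ) * (φ (v + u) : ℂ) ∂(adeleQuotHaar K) = ((∫ v, φ v * φ (v + u) ∂(adeleQuotHaar K) : ℝ) : ℂ) := by
  rw [← integral_complex_ofReal]
  exact integral_congr_ae (ae_of_all _ fun v => by simp only [Complex.ofReal_mul])

/-- `0 ≤ t_φ(u)` for `φ ≥ 0`. [cite: Weil1965, Chap. I n° 1 Lemme 3 p. 5] -/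
theorem fejer_re_nonneg {φ : adeleQuotient K → ℝ} (hφ0 : ∀ v, 0 ≤ φ v) (u : adeleQuotient K) :
    0 ≤ (∫ v, (φ v : ℂ) * (φ (v + u) : ℂ) ∂(adeleQuotHaar K)).re := by
  rw [fejer_eq_ofReal_of_nonneg K φ u, Complex.ofReal_re]
  exact integral_nonneg fun v => mul_nonneg (hφ0 v) (hφ0 (v + u))

/-- **support of the Fejér kernel**: `t_φ(u) = 0` unless `u = w − v` with `φ v ≠ 0 ≠ φ w` — i.e. `t_φ` is carried by
`supp φ − supp φ`. [cite: Weil1965, Chap. I n° 1 Lemme 3 p. 5] -/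
theorem fejer_eq_zero_of_forall {φ : adeleQuotient K → ℝ} {u : adeleQuotient K}
    (hu : ∀ v, φ v ≠ 0 → φ (v + u) = 0) :
    ∫ v, (φ v : ℂ) * (φ (v + u) : ℂ) ∂(adeleQuotHaar K) = 0 := by
  refine (integral_congr_ae (ae_of_all _ fun v => ?_)).trans (integral_zero _ _)
  by_cases hv : φ v = 0
  · rw [hv, Complex.ofReal_zero, zero_mul]
  · rw [hu v hv, Complex.ofReal_zero, mul_zero]

omit [MeasurableSpace (adeleQuotient K)] [BorelSpace (adeleQuotient K)] in
/-- `conj ψ_ξ(w − v) = conj ψ_ξ(w) · ψ_ξ(v)` (unit-modulus characters). [folklore] -/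
private theorem conj_adeleQuotChar_sub (ξ : K) (w v : adeleQuotient K) :
    conj (adeleQuotChar K ξ (w - v) : ℂ) = conj (adeleQuotChar K ξ w : ℂ) * (adeleQuotChar K ξ v : ℂ) := by
  have hmul : (adeleQuotChar K ξ (w - v) : ℂ) * (adeleQuotChar K ξ v : ℂ) = (adeleQuotChar K ξ w : ℂ) := by
    rw [← Circle.coe_mul, ← AddChar.map_add_eq_mul, sub_add_cancel]
  have hone : conj (adeleQuotChar K ξ v : ℂ) * (adeleQuotChar K ξ v : ℂ) = 1 := by
    rw [Complex.conj_mul', norm_adeleQuotChar, Complex.ofReal_one, one_pow]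
  calc conj (adeleQuotChar K ξ (w - v) : ℂ)
      = conj (adeleQuotChar K ξ (w - v) : ℂ) * (conj (adeleQuotChar K ξ v : ℂ) * (adeleQuotChar K ξ v : ℂ)) := by
        rw [hone, mul_one]
    _ = conj ((adeleQuotChar K ξ (w - v) : ℂ) * (adeleQuotChar K ξ v : ℂ)) * (adeleQuotChar K ξ v : ℂ) := by
        rw [map_mul, mul_assoc]
    _ = conj (adeleQuotChar K ξ w : ℂ) * (adeleQuotChar K ξ v : ℂ) := by rw [hmul]

/-- `∫ ψ_ξ φ = conj (∫ conj ψ_ξ · φ)` for real `φ`. [folklore] -/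
private theorem integral_adeleQuotChar_mul_ofReal (ξ : K) (φ : adeleQuotient K → ℝ) :
    ∫ w, (adeleQuotChar K ξ w : ℂ) * (φ w : ℂ) ∂(adeleQuotHaar K) =
      conj (∫ w, conj (adeleQuotChar K ξ w : ℂ) * (φ w : ℂ) ∂(adeleQuotHaar K)) := by
  rw [← integral_conj]
  exact integral_congr_ae (ae_of_all _ fun w => by simp only [map_mul, Complex.conj_conj, Complex.conj_ofReal])

/-- translated character integral: `∫ conj ψ_ξ(u) φ(v + u) du = ψ_ξ(v) · φ̂(ξ)`. [folklore] -/
private theorem integral_conj_adeleQuotChar_mul_translate (ξ : K) (φ : adeleQuotient K → ℝ) (v : adeleQuotient K) :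
    ∫ u, conj (adeleQuotChar K ξ u : ℂ) * (φ (v + u) : ℂ) ∂(adeleQuotHaar K) =
      (adeleQuotChar K ξ v : ℂ) * ∫ w, conj (adeleQuotChar K ξ w : ℂ) * (φ w : ℂ) ∂(adeleQuotHaar K) := by
  have htr := integral_comp_add_left K (fun w => conj (adeleQuotChar K ξ (w - v) : ℂ) * (φ w : ℂ)) v
  have hs : ∀ u : adeleQuotient K, conj (adeleQuotChar K ξ (v + u - v) : ℂ) * (φ (v + u) : ℂ) =
      conj (adeleQuotChar K ξ u : ℂ) * (φ (v + u) : ℂ) := fun u => by rw [add_sub_cancel_left]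
  simp only [hs] at htr
  rw [htr]
  simp only [conj_adeleQuotChar_sub]
  rw [← integral_const_mul]
  exact integral_congr_ae (ae_of_all _ fun w => by ring)

/-- **the Fourier coefficients of the Fejér kernel are `|φ̂(ξ)|²`**:
`∫ \overline{ψ_ξ(u)} t_φ(u) du = φ̂(ξ) · \overline{φ̂(ξ)}` with `φ̂(ξ) = ∫ \overline{ψ_ξ} φ` (Fubini on the probability space and
translation invariance `∫ g(v + u) du = ∫ g`). [cite: Weil1965, Chap. I n° 1 Lemme 1 p. 4] -/
theorem integral_conj_adeleQuotChar_mul_fejer {φ : adeleQuotient K → ℝ} (hφ : Continuous φ) (ξ : K) :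
    ∫ u, conj (adeleQuotChar K ξ u : ℂ) * ∫ v, (φ v : ℂ) * (φ (v + u) : ℂ) ∂(adeleQuotHaar K) ∂(adeleQuotHaar K) =
      (∫ v, conj (adeleQuotChar K ξ v : ℂ) * (φ v : ℂ) ∂(adeleQuotHaar K)) *
        conj (∫ v, conj (adeleQuotChar K ξ v : ℂ) * (φ v : ℂ) ∂(adeleQuotHaar K)) := by
  obtain ⟨M, hM0, hM⟩ := exists_forall_abs_le_of_continuous K hφ
  have hχc : Continuous fun u : adeleQuotient K => conj (adeleQuotChar K ξ u : ℂ) :=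
    Complex.continuous_conj.comp (continuous_adeleQuotChar K ξ)
  -- the integrand on `(𝔸/K)²`, `(u, v) ↦ conj ψ_ξ(u) φ(v) φ(v+u)`, is bounded and continuous, hence integrable
  have hFc : Continuous fun p : adeleQuotient K × adeleQuotient K =>
      conj (adeleQuotChar K ξ p.1 : ℂ) * ((φ p.2 : ℂ) * (φ (p.2 + p.1) : ℂ)) :=
    (hχc.comp continuous_fst).mul ((Complex.continuous_ofReal.comp (hφ.comp continuous_snd)).mul
      (Complex.continuous_ofReal.comp (hφ.comp (continuous_snd.add continuous_fst))))
  have hFi : Integrable (fun p : adeleQuotient K × adeleQuotient K =>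
      conj (adeleQuotChar K ξ p.1 : ℂ) * ((φ p.2 : ℂ) * (φ (p.2 + p.1) : ℂ)))
      ((adeleQuotHaar K).prod (adeleQuotHaar K)) := by
    refine Integrable.of_bound (C := M * M) hFc.aestronglyMeasurable (ae_of_all _ fun p => ?_)
    rw [norm_mul, RCLike.norm_conj, norm_adeleQuotChar, one_mul, norm_mul, Complex.norm_real, Complex.norm_real,
      Real.norm_eq_abs, Real.norm_eq_abs]
    exact mul_le_mul (hM _) (hM _) (abs_nonneg _) hM0
  -- pull the character inside, swap the integrals
  have h1 : ∫ u, conj (adeleQuotChar K ξ u : ℂ) * ∫ v, (φ v : ℂ) * (φ (v + u) : ℂ) ∂(adeleQuotHaar K) ∂(adeleQuotHaar K) =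
      ∫ u, ∫ v, conj (adeleQuotChar K ξ u : ℂ) * ((φ v : ℂ) * (φ (v + u) : ℂ)) ∂(adeleQuotHaar K) ∂(adeleQuotHaar K) :=
    integral_congr_ae (ae_of_all _ fun u => (integral_const_mul _ _).symm)
  rw [h1, integral_integral_swap hFi]
  -- inner integral in `u`: `∫ conj ψ_ξ(u) φ(v) φ(v + u) du = φ(v) ψ_ξ(v) φ̂(ξ)`
  have h2 : ∀ v : adeleQuotient K,
      ∫ u, conj (adeleQuotChar K ξ u : ℂ) * ((φ v : ℂ) * (φ (v + u) : ℂ)) ∂(adeleQuotHaar K) =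
        ((adeleQuotChar K ξ v : ℂ) * (φ v : ℂ)) *
          ∫ w, conj (adeleQuotChar K ξ w : ℂ) * (φ w : ℂ) ∂(adeleQuotHaar K) := by
    intro v
    have h3 : ∫ u, conj (adeleQuotChar K ξ u : ℂ) * ((φ v : ℂ) * (φ (v + u) : ℂ)) ∂(adeleQuotHaar K) =
        (φ v : ℂ) * ∫ u, conj (adeleQuotChar K ξ u : ℂ) * (φ (v + u) : ℂ) ∂(adeleQuotHaar K) := by
      rw [← integral_const_mul]
      exact integral_congr_ae (ae_of_all _ fun u => by ring)
    rw [h3, integral_conj_adeleQuotChar_mul_translate K ξ φ v]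
    ring
  simp only [h2]
  rw [integral_mul_const, integral_adeleQuotChar_mul_ofReal K ξ φ, mul_comm]

/-- **the coefficients as a real square**: `∫ \overline{ψ_ξ} t_φ = ‖φ̂(ξ)‖²` (so they are `≥ 0`, `≤ (∫|φ|)²`).
[cite: Weil1965, Chap. I n° 1 Lemme 1 p. 4] -/
theorem integral_conj_adeleQuotChar_mul_fejer_eq_norm_sq {φ : adeleQuotient K → ℝ} (hφ : Continuous φ) (ξ : K) :
    ∫ u, conj (adeleQuotChar K ξ u : ℂ) * ∫ v, (φ v : ℂ) * (φ (v + u) : ℂ) ∂(adeleQuotHaar K) ∂(adeleQuotHaar K) =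
      ((‖∫ v, conj (adeleQuotChar K ξ v : ℂ) * (φ v : ℂ) ∂(adeleQuotHaar K)‖ ^ 2 : ℝ) : ℂ) := by
  rw [integral_conj_adeleQuotChar_mul_fejer K hφ ξ, Complex.mul_conj, Complex.normSq_eq_norm_sq]

/-- **the coefficients of the Fejér kernel are summable** (Bessel's inequality for the continuous `φ`, ★
`summable_norm_sq_integral_conj_adeleQuotChar_mul`). [cite: Weil1965, Chap. I n° 1 Lemme 1 p. 4] -/
theorem summable_norm_integral_conj_adeleQuotChar_mul_fejer {φ : adeleQuotient K → ℝ} (hφ : Continuous φ) :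
    Summable fun ξ : K => ‖∫ u, conj (adeleQuotChar K ξ u : ℂ) *
      ∫ v, (φ v : ℂ) * (φ (v + u) : ℂ) ∂(adeleQuotHaar K) ∂(adeleQuotHaar K)‖ := by
  have hs := summable_norm_sq_integral_conj_adeleQuotChar_mul K
    (memLp_of_continuous K (f := fun v => (φ v : ℂ)) (Complex.continuous_ofReal.comp hφ))
  refine hs.congr fun ξ => ?_
  rw [integral_conj_adeleQuotChar_mul_fejer_eq_norm_sq K hφ ξ, Complex.norm_real, Real.norm_eq_abs,
    abs_of_nonneg (sq_nonneg _)]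

/-- `‖φ̂(ξ)‖ ≤ ∫ |φ|`; in particular `‖φ̂(ξ)‖ ≤ 1` when `φ ≥ 0` and `∫ φ = 1`. [folklore] -/
private theorem norm_integral_conj_adeleQuotChar_mul_le_one {φ : adeleQuotient K → ℝ} (hφ0 : ∀ v, 0 ≤ φ v)
    (hφ1 : ∫ v, φ v ∂(adeleQuotHaar K) = 1) (ξ : K) :
    ‖∫ v, conj (adeleQuotChar K ξ v : ℂ) * (φ v : ℂ) ∂(adeleQuotHaar K)‖ ≤ 1 := by
  refine (norm_integral_le_integral_norm _).trans ?_
  have h : ∀ v, ‖conj (adeleQuotChar K ξ v : ℂ) * (φ v : ℂ)‖ = φ v := fun v => by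
    rw [norm_mul, RCLike.norm_conj, norm_adeleQuotChar, one_mul, Complex.norm_real, Real.norm_eq_abs,
      abs_of_nonneg (hφ0 v)]
  simp only [h]
  exact hφ1.le

/-! ## §2 The Fejér-smoothed fibre integral as a Fourier series -/

variable {X : Type*} [MeasurableSpace X] (μX : Measure X)

/-- **`∫_X t_φ(f(x)) Φ(x) dx = Σ_ξ |φ̂(ξ)|² F*_Φ(ξ)`**, `F*_Φ(ξ) = ∫_X ψ_ξ(f x) Φ(x) dx`, for every measurable
`f : X → 𝔸_K ⧸ K` and every integrable `Φ` (pointwise inversion of the Fejér kernel, ★ `eq_tsum_integral_mul_adeleQuotChar`,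
and the dominated interchange `Σ_ξ |φ̂(ξ)|² ‖Φ‖₁ < ∞`). [cite: Weil1965, Chap. I n° 1 Lemme 1 p. 4] -/
theorem integral_fejer_comp_mul_eq_tsum {φ : adeleQuotient K → ℝ} (hφ : Continuous φ)
    {f : X → adeleQuotient K} (hf : Measurable f) {Φ : X → ℂ} (hΦ : Integrable Φ μX) :
    ∫ x, (∫ v, (φ v : ℂ) * (φ (v + f x) : ℂ) ∂(adeleQuotHaar K)) * Φ x ∂μX =
      ∑' ξ : K, (∫ u, conj (adeleQuotChar K ξ u : ℂ) * ∫ v, (φ v : ℂ) * (φ (v + u) : ℂ) ∂(adeleQuotHaar K)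
          ∂(adeleQuotHaar K)) * ∫ x, (adeleQuotChar K ξ (f x) : ℂ) * Φ x ∂μX := by
  haveI : Countable K := NumberField.countable' (K := K)
  have hsum := summable_norm_integral_conj_adeleQuotChar_mul_fejer K hφ
  -- pointwise inversion of the Fejér kernel at `f x`
  have hinv : ∀ x, (∫ v, (φ v : ℂ) * (φ (v + f x) : ℂ) ∂(adeleQuotHaar K)) * Φ x =
      ∑' ξ : K, ((∫ u, conj (adeleQuotChar K ξ u : ℂ) * ∫ v, (φ v : ℂ) * (φ (v + u) : ℂ) ∂(adeleQuotHaar K)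
          ∂(adeleQuotHaar K)) * ((adeleQuotChar K ξ (f x) : ℂ) * Φ x)) := by
    intro x
    rw [eq_tsum_integral_mul_adeleQuotChar K (continuous_fejer K hφ) hsum (f x), ← tsum_mul_right]
    exact tsum_congr fun ξ => by ring
  simp only [hinv]
  -- interchange
  have hintχ : ∀ ξ : K, Integrable (fun x => (adeleQuotChar K ξ (f x) : ℂ) * Φ x) μX := fun ξ =>
    hΦ.norm.mono' ((((continuous_adeleQuotChar K ξ).measurable.comp hf).aestronglyMeasurable).mul hΦ.1)
      (ae_of_all _ fun x => by rw [norm_mul, norm_adeleQuotChar, one_mul])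
  have hint : ∀ ξ : K, Integrable (fun x => (∫ u, conj (adeleQuotChar K ξ u : ℂ) *
      ∫ v, (φ v : ℂ) * (φ (v + u) : ℂ) ∂(adeleQuotHaar K) ∂(adeleQuotHaar K)) *
        ((adeleQuotChar K ξ (f x) : ℂ) * Φ x)) μX := fun ξ => (hintχ ξ).const_mul _
  rw [← integral_tsum_of_summable_integral_norm hint]
  · exact tsum_congr fun ξ => integral_const_mul _ _
  · refine (hsum.mul_right (∫ x, ‖Φ x‖ ∂μX)).congr fun ξ => ?_
    rw [← integral_const_mul]
    exact integral_congr_ae (ae_of_all _ fun x => by simp only [norm_mul, norm_adeleQuotChar, one_mul])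

/-! ## §3 Weil's limit formula (3): `Σ_ξ F*_Φ(ξ) = lim ∫ t_{φ_n}(f(x)) Φ(x) dx` -/

/-- `φ̂_n(ξ) → 1` when the non-negative normalised `φ_n` concentrate at `0` (continuity of `ψ_ξ` at `0`; Weil: «on a
`lim_W γ_W = 1`, uniformément sur toute partie compacte de `G*`»). [cite: Weil1965, Chap. I n° 1 p. 5] -/
theorem tendsto_integral_conj_adeleQuotChar_mul_of_support (φ : ℕ → adeleQuotient K → ℝ) (hφ0 : ∀ n v, 0 ≤ φ n v)
    (hφ1 : ∀ n, ∫ v, φ n v ∂(adeleQuotHaar K) = 1)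
    (hφs : ∀ U ∈ 𝓝 (0 : adeleQuotient K), ∀ᶠ n in atTop, ∀ v, φ n v ≠ 0 → v ∈ U) (ξ : K) :
    Tendsto (fun n => ∫ v, conj (adeleQuotChar K ξ v : ℂ) * (φ n v : ℂ) ∂(adeleQuotHaar K)) atTop (𝓝 1) := by
  rw [Metric.tendsto_atTop]
  intro ε hε
  -- continuity of `conj ψ_ξ` at `0`: `‖conj ψ_ξ(v) − 1‖ < ε/2` on a neighbourhood `U`
  have hc : ContinuousAt (fun v : adeleQuotient K => conj (adeleQuotChar K ξ v : ℂ)) 0 :=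
    (Complex.continuous_conj.comp (continuous_adeleQuotChar K ξ)).continuousAt
  have hU : (fun v : adeleQuotient K => conj (adeleQuotChar K ξ v : ℂ)) ⁻¹' Metric.ball 1 (ε / 2) ∈
      𝓝 (0 : adeleQuotient K) := by
    have h0 : conj (adeleQuotChar K ξ (0 : adeleQuotient K) : ℂ) = 1 := by
      rw [AddChar.map_zero_eq_one, Circle.coe_one, map_one]
    have hb : Metric.ball (1 : ℂ) (ε / 2) ∈ 𝓝 (conj (adeleQuotChar K ξ (0 : adeleQuotient K) : ℂ)) := by
      rw [h0]; exact Metric.ball_mem_nhds _ (half_pos hε)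
    exact hc.preimage_mem_nhds hb
  obtain ⟨N, hN⟩ := eventually_atTop.1 (hφs _ hU)
  refine ⟨N, fun n hn => ?_⟩
  have hiφ : Integrable (φ n) (adeleQuotHaar K) := by
    by_contra h
    have h1 := hφ1 n
    rw [integral_undef h] at h1
    exact zero_ne_one h1
  have hint1 : Integrable (fun v => (φ n v : ℂ)) (adeleQuotHaar K) := hiφ.ofReal
  have hint2 : Integrable (fun v => conj (adeleQuotChar K ξ v : ℂ) * (φ n v : ℂ)) (adeleQuotHaar K) :=
    hint1.norm.mono' ((Complex.continuous_conj.comp (continuous_adeleQuotChar K ξ)).aestronglyMeasurable.mul hint1.1)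
      (ae_of_all _ fun v => by rw [norm_mul, RCLike.norm_conj, norm_adeleQuotChar, one_mul])
  have h1 : (∫ v, conj (adeleQuotChar K ξ v : ℂ) * (φ n v : ℂ) ∂(adeleQuotHaar K)) - 1 =
      ∫ v, (conj (adeleQuotChar K ξ v : ℂ) - 1) * (φ n v : ℂ) ∂(adeleQuotHaar K) := by
    rw [show (fun v => (conj (adeleQuotChar K ξ v : ℂ) - 1) * (φ n v : ℂ)) =
        fun v => conj (adeleQuotChar K ξ v : ℂ) * (φ n v : ℂ) - (φ n v : ℂ) from funext fun v => by ring,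
      integral_sub hint2 hint1, integral_complex_ofReal, hφ1 n, Complex.ofReal_one]
  rw [dist_eq_norm, h1]
  calc ‖∫ v, (conj (adeleQuotChar K ξ v : ℂ) - 1) * (φ n v : ℂ) ∂(adeleQuotHaar K)‖
      ≤ ∫ v, ‖(conj (adeleQuotChar K ξ v : ℂ) - 1) * (φ n v : ℂ)‖ ∂(adeleQuotHaar K) := norm_integral_le_integral_norm _
    _ ≤ ∫ v, (ε / 2) * φ n v ∂(adeleQuotHaar K) := by
        refine integral_mono_of_nonneg (ae_of_all _ fun v => norm_nonneg _) (hiφ.const_mul _)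
          (ae_of_all _ fun v => ?_)
        show ‖(conj (adeleQuotChar K ξ v : ℂ) - 1) * (φ n v : ℂ)‖ ≤ ε / 2 * φ n v
        rw [norm_mul, Complex.norm_real, Real.norm_eq_abs, abs_of_nonneg (hφ0 n v)]
        by_cases hv : φ n v = 0
        · rw [hv, mul_zero, mul_zero]
        · have hv' := hN n hn v hv
          rw [Set.mem_preimage, Metric.mem_ball, dist_eq_norm] at hv'
          exact mul_le_mul_of_nonneg_right (le_of_lt hv') (hφ0 n v)
    _ = ε / 2 := by rw [integral_const_mul, hφ1 n, mul_one]
    _ < ε := half_lt_self hε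

/-- **WEIL'S LIMIT FORMULA (Lemme 1 (3) with `T = δ₀` on `𝔸_K ⧸ K`)**: if `S(Φ) := Σ_{ξ∈K} F*_Φ(ξ)`,
`F*_Φ(ξ) = ∫_X ψ_ξ(f x) Φ(x) dx`, converges ABSOLUTELY, then for every sequence of continuous `φ_n ≥ 0`, `∫ φ_n = 1`,
concentrating at `0`, the Fejér-smoothed integrals converge to it: `∫_X t_{φ_n}(f x) Φ(x) dx ⟶ S(Φ)`.
[cite: Weil1965, Chap. I n° 1 Lemme 1 p. 4] -/
theorem tendsto_integral_fejer_comp_mul (φ : ℕ → adeleQuotient K → ℝ) (hφc : ∀ n, Continuous (φ n))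
    (hφ0 : ∀ n v, 0 ≤ φ n v) (hφ1 : ∀ n, ∫ v, φ n v ∂(adeleQuotHaar K) = 1)
    (hφs : ∀ U ∈ 𝓝 (0 : adeleQuotient K), ∀ᶠ n in atTop, ∀ v, φ n v ≠ 0 → v ∈ U)
    {f : X → adeleQuotient K} (hf : Measurable f) {Φ : X → ℂ} (hΦ : Integrable Φ μX)
    (hA : Summable fun ξ : K => ‖∫ x, (adeleQuotChar K ξ (f x) : ℂ) * Φ x ∂μX‖) :
    Tendsto (fun n => ∫ x, (∫ v, (φ n v : ℂ) * (φ n (v + f x) : ℂ) ∂(adeleQuotHaar K)) * Φ x ∂μX) atTop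
      (𝓝 (∑' ξ : K, ∫ x, (adeleQuotChar K ξ (f x) : ℂ) * Φ x ∂μX)) := by
  have heq : ∀ n, ∫ x, (∫ v, (φ n v : ℂ) * (φ n (v + f x) : ℂ) ∂(adeleQuotHaar K)) * Φ x ∂μX =
      ∑' ξ : K, ((‖∫ v, conj (adeleQuotChar K ξ v : ℂ) * (φ n v : ℂ) ∂(adeleQuotHaar K)‖ ^ 2 : ℝ) : ℂ) *
        ∫ x, (adeleQuotChar K ξ (f x) : ℂ) * Φ x ∂μX := fun n => by
    rw [integral_fejer_comp_mul_eq_tsum K μX (hφc n) hf hΦ]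
    exact tsum_congr fun ξ => by rw [integral_conj_adeleQuotChar_mul_fejer_eq_norm_sq K (hφc n) ξ]
  simp only [heq]
  have h1 : (fun ξ : K => ∫ x, (adeleQuotChar K ξ (f x) : ℂ) * Φ x ∂μX) =
      fun ξ : K => ((‖(1 : ℂ)‖ ^ 2 : ℝ) : ℂ) * ∫ x, (adeleQuotChar K ξ (f x) : ℂ) * Φ x ∂μX := by
    funext ξ; rw [norm_one, one_pow, Complex.ofReal_one, one_mul]
  rw [h1]
  refine tendsto_tsum_of_dominated_convergence hA (fun ξ => ?_) (Eventually.of_forall fun n ξ => ?_)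
  · exact ((Complex.continuous_ofReal.tendsto _).comp (((continuous_norm.pow 2).tendsto _).comp
      (tendsto_integral_conj_adeleQuotChar_mul_of_support K φ hφ0 hφ1 hφs ξ))).mul tendsto_const_nhds
  · rw [norm_mul, Complex.norm_real, Real.norm_eq_abs, abs_of_nonneg (sq_nonneg _)]
    refine mul_le_of_le_one_left (norm_nonneg _) ?_
    rw [sq_le_one_iff_abs_le_one, abs_of_nonneg (norm_nonneg _)]
    exact norm_integral_conj_adeleQuotChar_mul_le_one K (hφ0 n) (hφ1 n) ξ

/-- **POSITIVITY (Lemme 3: «si `T` est une mesure positive, il en est de même de `S`»)**: for `Φ ≥ 0` (real-valued),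
`S(Φ) = Σ_ξ F*_Φ(ξ)` is a non-negative real number, provided a concentrating sequence `φ_n` exists (§4).
[cite: Weil1965, Chap. I n° 2 Lemme 3 p. 5] -/
theorem tsum_integral_adeleQuotChar_comp_mul_nonneg (φ : ℕ → adeleQuotient K → ℝ) (hφc : ∀ n, Continuous (φ n))
    (hφ0 : ∀ n v, 0 ≤ φ n v) (hφ1 : ∀ n, ∫ v, φ n v ∂(adeleQuotHaar K) = 1)
    (hφs : ∀ U ∈ 𝓝 (0 : adeleQuotient K), ∀ᶠ n in atTop, ∀ v, φ n v ≠ 0 → v ∈ U)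
    {f : X → adeleQuotient K} (hf : Measurable f) {Φ : X → ℝ} (hΦ : Integrable Φ μX) (hΦ0 : ∀ x, 0 ≤ Φ x)
    (hA : Summable fun ξ : K => ‖∫ x, (adeleQuotChar K ξ (f x) : ℂ) * (Φ x : ℂ) ∂μX‖) :
    0 ≤ (∑' ξ : K, ∫ x, (adeleQuotChar K ξ (f x) : ℂ) * (Φ x : ℂ) ∂μX).re ∧
      (∑' ξ : K, ∫ x, (adeleQuotChar K ξ (f x) : ℂ) * (Φ x : ℂ) ∂μX).im = 0 := by
  have ht := tendsto_integral_fejer_comp_mul K μX φ hφc hφ0 hφ1 hφs hf hΦ.ofReal hA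
  -- each term of the sequence is a non-negative real
  have hreal : ∀ n, ∫ x, (∫ v, (φ n v : ℂ) * (φ n (v + f x) : ℂ) ∂(adeleQuotHaar K)) * (Φ x : ℂ) ∂μX =
      ((∫ x, (∫ v, φ n v * φ n (v + f x) ∂(adeleQuotHaar K)) * Φ x ∂μX : ℝ) : ℂ) := fun n => by
    rw [← integral_complex_ofReal]
    exact integral_congr_ae (ae_of_all _ fun x => by
      simp only [fejer_eq_ofReal_of_nonneg K (φ n) (f x), Complex.ofReal_mul])
  have hnn : ∀ n, 0 ≤ ∫ x, (∫ v, φ n v * φ n (v + f x) ∂(adeleQuotHaar K)) * Φ x ∂μX := fun n =>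
    integral_nonneg fun x => mul_nonneg (integral_nonneg fun v => mul_nonneg (hφ0 n v) (hφ0 n _)) (hΦ0 x)
  constructor
  · refine ge_of_tendsto ((Complex.continuous_re.tendsto _).comp ht) (Eventually.of_forall fun n => ?_)
    show 0 ≤ (∫ x, (∫ v, (φ n v : ℂ) * (φ n (v + f x) : ℂ) ∂(adeleQuotHaar K)) * (Φ x : ℂ) ∂μX).re
    rw [hreal n, Complex.ofReal_re]
    exact hnn n
  · have him : ∀ n, (∫ x, (∫ v, (φ n v : ℂ) * (φ n (v + f x) : ℂ) ∂(adeleQuotHaar K)) * (Φ x : ℂ) ∂μX).im = 0 :=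
      fun n => by rw [hreal n, Complex.ofReal_im]
    exact tendsto_nhds_unique ((Complex.continuous_im.tendsto _).comp ht)
      (tendsto_const_nhds.congr' (Eventually.of_forall fun n => (him n).symm))

/-- **SUPPORT (Lemme 3: «de support contenu dans `f⁻¹(supp T)`»)**: if `f` stays outside a neighbourhood `U` of `0` wherever
`Φ ≠ 0`, then `S(Φ) = Σ_ξ F*_Φ(ξ) = 0` (the Fejér kernels `t_{φ_n}` vanish at `f(x)` once `supp φ_n − supp φ_n ⊆ U`).
[cite: Weil1965, Chap. I n° 2 Lemme 3 p. 5] -/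
theorem tsum_integral_adeleQuotChar_comp_mul_eq_zero_of_forall_notMem (φ : ℕ → adeleQuotient K → ℝ)
    (hφc : ∀ n, Continuous (φ n)) (hφ0 : ∀ n v, 0 ≤ φ n v) (hφ1 : ∀ n, ∫ v, φ n v ∂(adeleQuotHaar K) = 1)
    (hφs : ∀ U ∈ 𝓝 (0 : adeleQuotient K), ∀ᶠ n in atTop, ∀ v, φ n v ≠ 0 → v ∈ U)
    {f : X → adeleQuotient K} (hf : Measurable f) {Φ : X → ℂ} (hΦ : Integrable Φ μX)
    (hA : Summable fun ξ : K => ‖∫ x, (adeleQuotChar K ξ (f x) : ℂ) * Φ x ∂μX‖)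
    {U : Set (adeleQuotient K)} (hU : U ∈ 𝓝 (0 : adeleQuotient K)) (hfU : ∀ x, Φ x ≠ 0 → f x ∉ U) :
    ∑' ξ : K, ∫ x, (adeleQuotChar K ξ (f x) : ℂ) * Φ x ∂μX = 0 := by
  have ht := tendsto_integral_fejer_comp_mul K μX φ hφc hφ0 hφ1 hφs hf hΦ hA
  -- a neighbourhood `V` of `0` with `V − V ⊆ U`… additively: `w ∈ V, v ∈ V ⇒ w - v ∈ U`
  have hsub : Tendsto (fun p : adeleQuotient K × adeleQuotient K => p.1 - p.2) (𝓝 ((0 : adeleQuotient K), 0))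
      (𝓝 0) :=
    (continuous_sub (G := adeleQuotient K)).tendsto' ((0 : adeleQuotient K), (0 : adeleQuotient K)) 0 (sub_zero _)
  obtain ⟨V, hV, hVU⟩ : ∃ V ∈ 𝓝 (0 : adeleQuotient K), ∀ w ∈ V, ∀ v ∈ V, w - v ∈ U := by
    have h := hsub hU
    rw [nhds_prod_eq, Filter.mem_map, Filter.mem_prod_iff] at h
    obtain ⟨V₁, hV₁, V₂, hV₂, hV⟩ := h
    exact ⟨V₁ ∩ V₂, inter_mem hV₁ hV₂, fun w hw v hv => hV (mk_mem_prod hw.1 hv.2)⟩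
  -- eventually the smoothed integrals vanish identically
  have hev : ∀ᶠ n in atTop, ∫ x, (∫ v, (φ n v : ℂ) * (φ n (v + f x) : ℂ) ∂(adeleQuotHaar K)) * Φ x ∂μX = 0 := by
    filter_upwards [hφs V hV] with n hn
    refine (integral_congr_ae (ae_of_all _ fun x => ?_)).trans (integral_zero _ _)
    by_cases hx : Φ x = 0
    · rw [hx, mul_zero]
    · have h0 : ∫ v, (φ n v : ℂ) * (φ n (v + f x) : ℂ) ∂(adeleQuotHaar K) = 0 :=
        fejer_eq_zero_of_forall K fun v hv => by
          by_contra hw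
          exact hfU x hx (by simpa only [add_sub_cancel_left] using hVU (v + f x) (hn _ hw) v (hn _ hv))
      rw [h0, zero_mul]
  exact tendsto_nhds_unique (tendsto_const_nhds.congr' (hev.mono fun n hn => hn.symm)) ht |>.symm

/-! ## §4 Concentrating sequences exist -/

/-- **Fejér approximate units exist on `𝔸_K ⧸ K`**: a sequence of continuous `φ_n : 𝔸_K ⧸ K → [0, ∞)` with `∫ φ_n = 1`
whose supports shrink to `0` (Urysohn on the compact Hausdorff second-countable group; the Haar measure charges open
sets) — the functions «`φ_W` continue `≥ 0`, de support contenu dans `W`, telle que `∫ φ_W dg = 1`» of Weil's Lemme 1.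
[cite: Weil1965, Chap. I n° 1 Lemme 1 p. 4] -/
theorem exists_fejer_approximateUnit :
    ∃ φ : ℕ → adeleQuotient K → ℝ, (∀ n, Continuous (φ n)) ∧ (∀ n v, 0 ≤ φ n v) ∧
      (∀ n, ∫ v, φ n v ∂(adeleQuotHaar K) = 1) ∧
      ∀ U ∈ 𝓝 (0 : adeleQuotient K), ∀ᶠ n in atTop, ∀ v, φ n v ≠ 0 → v ∈ U := by
  -- a decreasing countable basis of open neighbourhoods of `0`
  obtain ⟨W, hW⟩ := (𝓝 (0 : adeleQuotient K)).exists_antitone_basis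
  -- Urysohn functions `g_n = 1` at `0`, `= 0` off the interior of `W n`
  have hg : ∀ n, ∃ g : C(adeleQuotient K, ℝ), g 0 = 1 ∧ (∀ v, g v ≠ 0 → v ∈ W n) ∧ ∀ v, g v ∈ Icc (0 : ℝ) 1 := by
    intro n
    have hWn : W n ∈ 𝓝 (0 : adeleQuotient K) := hW.1.mem_of_mem trivial
    obtain ⟨g, hg1, hg0, -, hg01⟩ := exists_continuous_one_zero_of_isCompact (isCompact_singleton (x := (0 : adeleQuotient K)))
      isOpen_interior.isClosed_compl (disjoint_compl_right_iff_subset.2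
        (singleton_subset_iff.2 (mem_interior_iff_mem_nhds.2 hWn)))
    refine ⟨g, hg1 rfl, fun v hv => interior_subset ?_, hg01⟩
    by_contra h
    exact hv (hg0 h)
  choose g hg1 hgs hg01 using hg
  -- positive mass
  have hpos : ∀ n, 0 < ∫ v, g n v ∂(adeleQuotHaar K) := by
    intro n
    have hnn : ∀ v, 0 ≤ g n v := fun v => (hg01 n v).1
    have hint : Integrable (g n) (adeleQuotHaar K) :=
      (g n).continuous.integrable_of_hasCompactSupport (HasCompactSupport.of_compactSpace _)
    rw [integral_pos_iff_support_of_nonneg hnn hint]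
    refine (isOpen_ne.preimage (g n).continuous |>.measure_pos (adeleQuotHaar K) ⟨0, ?_⟩)
    show g n 0 ≠ 0
    rw [hg1 n]; exact one_ne_zero
  refine ⟨fun n v => g n v / ∫ w, g n w ∂(adeleQuotHaar K), fun n => (g n).continuous.div_const _,
    fun n v => div_nonneg (hg01 n v).1 (hpos n).le, fun n => ?_, fun U hU => ?_⟩
  · rw [integral_div, div_self (hpos n).ne']
  · obtain ⟨N, hN⟩ : ∃ N, W N ⊆ U := (hW.1.mem_iff.1 hU).imp fun N h => h.2
    refine eventually_atTop.2 ⟨N, fun n hn v hv => hN (hW.antitone hn (hgs n v ?_))⟩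
    intro h
    exact hv (show g n v / _ = 0 by rw [h, zero_div])

end Fejer

end Literature.NumberTheory.Automorphic

end
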